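import Literature.NumberTheory.Automorphic.PairLFunctionPolesRepData
import Literature.NumberTheory.Automorphic.PairLFunctionPolesChangeOfS
import Literature.NumberTheory.Automorphic.SatakeParameterBoundHolds
import HarnessLib

/-!
# Arthur–Clozel (2.3) for Borel–Jacquet data from (2.3) in `L²` alone (proofs only)

Topic `NumberTheory/Automorphic`; namespace `Literature.NumberTheory.Automorphic`. Proof file
(theorems only: no definition, no named fact, no instance), sibling of
`PairLFunctionPolesRepData`, under its named fact `JacquetShalika1981_partialPairL_pole_repData` —
Arthur–Clozel, *Simple algebras, base change, and the advanced theory of the trace formula*,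
Ann. of Math. Stud. 120 (1989), Ch. 3 §2, (2.3), p. 171 of the held copy: for unitary cuspidal
`π`, `σ` on `GL_n(𝔸_F)` and `s₀ ∈ X` (`π ⊗ | |^{s₀-1} ≅ σ̃`), "the limit
`lim_{s → s₀, Re s > 1} (s - s₀) L^S(s, π ⊗ σ)` exists and is finite and non-zero"
(Jacquet–Shalika II, Prop. 3.6), in the Borel–Jacquet model `CuspidalAutomorphicRepData`.

`PairLFunctionPolesRepData` reduces that fact to **seven** named facts of the tree
(`JacquetShalika1981_partialPairL_pole_repData_of_leaves`): the `L²` forms of (2.2) at `s₀ = 1`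
for `π ≇ σ̃` (`JacquetShalika1981_partialPairL_at_one_of_ne_conj`), of (2.2) on `Re s = 1` off `1`
(`…_boundary_of_ne_one`) and of (2.3) (`…_pole_of_eq_conj`), multiplicity one on `L²_cusp(GL_n)`
(`multiplicity_one_gl`), and the Borel–Jacquet dictionary (`AutomorphicRepsGL.exists_isAssociatedL2`,
`hasSatakeParamAt_iff_L2`, `AutomorphicRepsGL.stable_cuspidal_eq_sSup_irreducible`). The two
(2.2) facts and multiplicity one enter only through the `L²` rigidity theorem
`CuspidalAutomorphicRepGL.eq_of_satakeTensor_conj_shift`, used to upgrade the hypothesis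
"`q_w^{1-s₀} t_{π,w} = t_{σ,w}⁻¹` for almost all `w`" to an identity of `L²` constituents.

This file removes them: **(2.3) for Borel–Jacquet data follows from (2.3) in `L²` and the
dictionary alone** (`JacquetShalika1981_partialPairL_pole_repData_of_L2'`, `…_of_leaves'`).
The argument (Jacquet–Shalika's own bookkeeping, *Euler products … I*, (5.1) p. 554, "`S` …
large enough", and II, Prop. 3.6):

1. *Direct shift.* Normalise `t_π = q^{s₁} t_{π₀}`, `t_σ = q^{s₂} t_{σ₀}` with `π₀`, `σ₀ ⊂ L²_cusp`
   unitary (`CuspidalAutomorphicRepData.exists_pair_satake_eq_cpow_mul_L2`), `re sᵢ = 0`. Off the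
   finite set `T = S ∪ E` (`E` the exceptional set of `s₀ ∈ X`) the hypothesis reads
   `t_{σ₀,w} = q_w^{-u} \bar t_{π₀,w}`, `u = 1 - s₀ + s₁ + s₂`, `re u = 0` (`t⁻¹ = t̄` for unitary
   `L²` families, `IsSatakeFamilyOf.map_inv_eq_map_conj`), so factor by factor
   `L^T(s, π ⊗ σ) = L^T(s + 1 - s₀, π₀ ⊗ π̄₀)` and the simple pole of `L^T(·, π₀ ⊗ π̄₀)` at `1`
   ((2.3) in `L²` for the pair `(π₀, π̄₀)`) is a simple pole of `L^T(·, π ⊗ σ)` at `s₀`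
   (`tendsto_sub_mul_partialPairL_of_shift`). No rigidity is needed for this step.
2. *Change of `S`* (`T ↓ S`, `exists_ne_zero_tendsto_mul_partialPairL_of_subset` of
   `PairLFunctionPolesChangeOfS`): the finitely many unramified factors
   `det(1 - t_{π,w} ⊗ t_{σ,w} q_w^{-s})⁻¹`, `w ∈ T ∖ S`, are finite at `s₀` because no product of
   Satake parameters of `π₀`, `σ₀` has absolute value `q_w` — Jacquet–Shalika's **strict** bound
   `|a| < q_w^{1/2}` (I, Cor. (2.5)) for `π₀` together with `|b| ≤ q_w^{1/2}` ((5.1.3), the tree's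
   theorem `norm_satakeParameter_le_sqrt_holds`) for `σ₀`
   (`eval_satakePairPolynomial_ne_zero_of_lt_sqrt`).
3. *The strict bound from (2.3)* (`norm_lt_sqrt_of_pole_of_eq_conj`, the one new observation):
   (2.3) in `L²` is stated for **every** finite set of places off which the families are Satake
   families; comparing it for `S₀` and `S₀ ∪ {v}` (the `S₀ ∪ {v}`-product being multipliable for
   `Re s > 1` by the tree's theorem (2.1), `JacquetShalika1981_multipliable_partialPairL_holds`)
   shows that the single factor `det(1 - \bar t_{π₀,v} ⊗ t_{π₀,v} q_v^{-s})` has a non-zero value at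
   `s = 1` (`eval_satakePairPolynomial_ne_zero_of_tendsto_insert`), i.e. `ā' a ≠ q_v` for all Satake
   parameters `a, a'` at `v`; with `a' = a`, `|a|² ≠ q_v`, and with (5.1.3) `|a| < q_v^{1/2}`. (In
   print the strict bound is local — unitary generic unramified representations, Cor. (2.5) — and
   (2.3) is deduced with it; here the implication is run backwards, so that the single named fact
   (2.3) carries both.)

Resulting dependence: `JacquetShalika1981_partialPairL_pole_repData` follows from the discharges of
`JacquetShalika1981_partialPairL_pole_of_eq_conj`, `AutomorphicRepsGL.exists_isAssociatedL2`,
`hasSatakeParamAt_iff_L2` and `AutomorphicRepsGL.stable_cuspidal_eq_sSup_irreducible` (four leaves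
instead of seven).

## References

* J. Arthur, L. Clozel, *Simple algebras, base change, and the advanced theory of the trace
  formula*, Ann. of Math. Stud. 120 (1989), Ch. 3 §2, (2.1)–(2.3), p. 171. [ArthurClozelAMS120]
* H. Jacquet, J. A. Shalika, *On Euler products and the classification of automorphic
  representations I*, Amer. J. Math. 103 (1981), 499–558, Cor. (2.5) p. 515, (5.1) p. 554,
  (5.1.3), Thm. (5.3). [JacquetShalikaAJM1981]
* H. Jacquet, J. A. Shalika, *On Euler products and the classification of automorphic forms II*,
  Amer. J. Math. 103 (1981), 777–815, Prop. 3.6. [JacquetShalikaAJM1981II]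
* A. Borel, H. Jacquet, *Automorphic forms and automorphic representations*, Proc. Sympos. Pure
  Math. 33 (1979), part 1, §4.6, 5.7. [BorelJacquetCorvallis1979]
-/

noncomputable section

open scoped MatrixGroups Topology Classical
open NumberField IsDedekindDomain MeasureTheory Filter

namespace Literature.NumberTheory.Automorphic

open AdelicGroupData

/-! ### One Euler factor from two boundary statements -/

section OneFactor

variable {K : Type} [Field K] [NumberField K]

/-- **One Euler factor is controlled by the partial `L`-functions with and without it.** Let
`v ∉ S`, `w` any weight and `s₀` a point at which the boundary filter "`s → s₀`, `Re s > 1`" is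
non-trivial. If the Euler product over `u ∉ S ∪ {v}` is multipliable for `Re s > 1` near `s₀` and
both `w(s) L^S(s, α ⊗ β) → c ≠ 0` and `w(s) L^{S ∪ {v}}(s, α ⊗ β) → c' ≠ 0` as `s → s₀`, `Re s > 1`,
then the inverse factor at `v` does not vanish at `s₀`: `det(1 - A_v ⊗ B_v q_v^{-s₀}) ≠ 0`. Indeed
`L^S = det(1 - A_v ⊗ B_v q_v^{-s})⁻¹ · L^{S ∪ {v}}` near `s₀` (`partialPairL_eq_prod_mul_partialPairL`),
so where `w L^S ≠ 0` the factor is invertible and `det(1 - A_v ⊗ B_v q_v^{-s}) · w L^S = w L^{S ∪ {v}}`;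
if the determinant vanished at `s₀` the left side would tend to `0 · c = 0 ≠ c'`. This is the
bookkeeping of "`S` … large enough" (Jacquet–Shalika I, (5.1)) read backwards. [folklore] -/
theorem eval_satakePairPolynomial_ne_zero_of_tendsto_insert {S : Set (HeightOneSpectrum (𝓞 K))}
    {α β : SatakeFamily K} {v : HeightOneSpectrum (𝓞 K)} (hv : v ∉ S) {s₀ : ℂ}
    (hl : (𝓝[{s : ℂ | 1 < s.re}] s₀).NeBot) (w : ℂ → ℂ)
    (hmul : ∀ᶠ s in 𝓝[{s : ℂ | 1 < s.re}] s₀,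
      Multipliable fun u : {u : HeightOneSpectrum (𝓞 K) // u ∉ insert v S} =>
        ((satakePairPolynomial (α u.1) (β u.1)).eval ((u.1.residueCard : ℂ) ^ (-s)))⁻¹)
    {c c' : ℂ} (hc : c ≠ 0) (hc' : c' ≠ 0)
    (h : Tendsto (fun s => w s * partialPairL S α β s) (𝓝[{s : ℂ | 1 < s.re}] s₀) (𝓝 c))
    (h' : Tendsto (fun s => w s * partialPairL (insert v S) α β s) (𝓝[{s : ℂ | 1 < s.re}] s₀)
      (𝓝 c')) :
    (satakePairPolynomial (α v) (β v)).eval ((v.residueCard : ℂ) ^ (-s₀)) ≠ 0 := by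
  haveI := hl
  intro h0
  have hSS' : S ⊆ insert v S := Set.subset_insert v S
  have hfin : (insert v S \ S).Finite :=
    (Set.finite_singleton v).subset fun u hu => by
      rcases hu with ⟨hu | hu, hu'⟩
      · exact hu
      · exact absurd hu hu'
  have htoF : hfin.toFinset = {v} := by
    ext u
    simp only [Set.Finite.mem_toFinset, Set.mem_sdiff, Set.mem_insert_iff, Finset.mem_singleton]
    constructor
    · rintro ⟨rfl | hu, hu'⟩
      · rfl
      · exact absurd hu hu'
    · rintro rfl
      exact ⟨Or.inl rfl, hv⟩
  -- the inverse factor at `v` tends to its value `0` at `s₀`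
  have hFt : Tendsto (fun s : ℂ => (satakePairPolynomial (α v) (β v)).eval
      ((v.residueCard : ℂ) ^ (-s))) (𝓝[{s : ℂ | 1 < s.re}] s₀) (𝓝 0) := by
    have hc0 := ((continuous_eval_satakePairPolynomial_cpow (α v) (β v)
      (zero_lt_one.trans v.one_lt_residueCard)).tendsto s₀).mono_left
      (nhdsWithin_le_nhds (s := {s : ℂ | 1 < s.re}))
    rwa [h0] at hc0
  -- near `s₀`: `det(1 - A_v ⊗ B_v q_v^{-s}) · (w L^S) = w L^{S ∪ {v}}`
  have hfg : ∀ᶠ s in 𝓝[{s : ℂ | 1 < s.re}] s₀,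
      (satakePairPolynomial (α v) (β v)).eval ((v.residueCard : ℂ) ^ (-s)) *
          (w s * partialPairL S α β s) = w s * partialPairL (insert v S) α β s := by
    filter_upwards [hmul, h.eventually_ne hc] with s hs hne
    have hsplit := partialPairL_eq_prod_mul_partialPairL hSS' hfin α β hs
    rw [htoF, Finset.prod_singleton] at hsplit
    have hF0 : (satakePairPolynomial (α v) (β v)).eval ((v.residueCard : ℂ) ^ (-s)) ≠ 0 := by
      intro hFs
      apply hne
      rw [hsplit, hFs, inv_zero, zero_mul, mul_zero]
    rw [hsplit]
    calc (satakePairPolynomial (α v) (β v)).eval ((v.residueCard : ℂ) ^ (-s)) *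
          (w s * (((satakePairPolynomial (α v) (β v)).eval ((v.residueCard : ℂ) ^ (-s)))⁻¹ *
            partialPairL (insert v S) α β s))
        = ((satakePairPolynomial (α v) (β v)).eval ((v.residueCard : ℂ) ^ (-s)) *
            ((satakePairPolynomial (α v) (β v)).eval ((v.residueCard : ℂ) ^ (-s)))⁻¹) *
            (w s * partialPairL (insert v S) α β s) := by ring
      _ = w s * partialPairL (insert v S) α β s := by rw [mul_inv_cancel₀ hF0, one_mul]
  have hlim0 : Tendsto (fun s => w s * partialPairL (insert v S) α β s)
      (𝓝[{s : ℂ | 1 < s.re}] s₀) (𝓝 (0 * c)) := (hFt.mul h).congr' hfg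
  rw [zero_mul] at hlim0
  exact hc' (tendsto_nhds_unique h' hlim0)

/-- `conj (q ^ u) = q ^ (-u)` for a natural number `q` and purely imaginary `u`. [folklore] -/
theorem conj_natCast_cpow_of_re_eq_zero {u : ℂ} (hu : u.re = 0) (q : ℕ) :
    starRingEnd ℂ ((q : ℂ) ^ u) = (q : ℂ) ^ (-u) := by
  have harg : (q : ℂ).arg ≠ Real.pi := by
    rw [Complex.natCast_arg]
    exact Real.pi_pos.ne
  have hconj_u : starRingEnd ℂ u = -u := by
    apply Complex.ext <;> simp [hu]
  calc starRingEnd ℂ ((q : ℂ) ^ u) = starRingEnd ℂ ((starRingEnd ℂ (q : ℂ)) ^ u) := by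
        rw [Complex.conj_natCast]
    _ = (q : ℂ) ^ (starRingEnd ℂ u) := (Complex.cpow_conj _ _ harg).symm
    _ = (q : ℂ) ^ (-u) := by rw [hconj_u]

end OneFactor

/-! ### Jacquet–Shalika's strict bound `|a| < q_v^{1/2}` from (2.3) -/

section StrictBound

variable {n : ℕ} {K : Type} [Field K] [NumberField K]
  {μ : Measure (gl n K).automorphicQuotient} [(gl n K).IsAutomorphicMeasure μ]

/-- **(2.3) forces `det(1 - \bar t_{π,v} ⊗ t_{π,v} q_v^{-1}) ≠ 0` at every unramified place.** For a
cuspidal `π ⊂ L²_cusp(GL_n)` (`n ≥ 1`) with Satake family `α` off a finite `S` and `v ∉ S`, the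
named fact (2.3) (`JacquetShalika1981_partialPairL_pole_of_eq_conj`, for the pair `(π̄, π)`, once
off `S` and once off `S ∪ {v}`) and the theorem (2.1)
(`JacquetShalika1981_multipliable_partialPairL_holds`) give, by
`eval_satakePairPolynomial_ne_zero_of_tendsto_insert`, that the unramified factor
`L(s, π̄_v × π_v) = det(1 - \bar t_{π,v} ⊗ t_{π,v} q_v^{-s})⁻¹` is finite at `s = 1` (in print a
consequence of Jacquet–Shalika I, Cor. (2.5): the Satake parameters of a unitary generic unramified
representation are `< q_v^{1/2}` in absolute value).
[cite: ArthurClozelAMS120, Ch. 3 §2 (2.3)] [cite: JacquetShalikaAJM1981, Cor. (2.5) p. 515] -/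
theorem eval_satakePairPolynomial_conj_ne_zero_of_pole
    (h23 : JacquetShalika1981_partialPairL_pole_of_eq_conj (n := n) (K := K) (μ := μ))
    (hn : 0 < n) (P : CuspidalAutomorphicRepGL n K μ) {S : Set (HeightOneSpectrum (𝓞 K))}
    (hS : S.Finite) {α : SatakeFamily K} (hα : IsSatakeFamilyOf P S α)
    {v : HeightOneSpectrum (𝓞 K)} (hv : v ∉ S) :
    (satakePairPolynomial ((α v).map (starRingEnd ℂ)) (α v)).eval
      ((v.residueCard : ℂ) ^ (-(1 : ℂ))) ≠ 0 := by
  have hγ : IsSatakeFamilyOf P.conj S fun u => (α u).map (starRingEnd ℂ) := hα.conj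
  have hSS' : S ⊆ insert v S := Set.subset_insert v S
  obtain ⟨c, hc, hlim⟩ := h23 hn P.conj P rfl hS hγ hα
  obtain ⟨c', hc', hlim'⟩ := h23 hn P.conj P rfl (hS.insert v) (hγ.mono hSS') (hα.mono hSS')
  refine eval_satakePairPolynomial_ne_zero_of_tendsto_insert (α := fun u => (α u).map (starRingEnd ℂ))
    hv nhdsWithin_one_lt_re_neBot (fun s => s - 1) ?_ hc hc' hlim hlim'
  filter_upwards [self_mem_nhdsWithin] with s hs
  exact JacquetShalika1981_multipliable_partialPairL_holds P.conj P (hγ.mono hSS') (hα.mono hSS') hs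

/-- **Jacquet–Shalika's strict bound from (2.3).** For a cuspidal `π ⊂ L²_cusp(GL_n)` (`n ≥ 1`)
with Satake family `α` off a finite `S`, `v ∉ S` and `a ∈ α v`: granted the named fact (2.3)
(`JacquetShalika1981_partialPairL_pole_of_eq_conj`), `|a| < q_v^{1/2}` — the factor
`det(1 - \bar t_{π,v} ⊗ t_{π,v} q_v^{-1}) = ∏_{a', a} (1 - \bar a' a q_v^{-1})` is non-zero
(`eval_satakePairPolynomial_conj_ne_zero_of_pole`), so `|a|² = ā a ≠ q_v`, while `|a| ≤ q_v^{1/2}`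
is Jacquet–Shalika's (5.1.3), a theorem of the tree (`norm_satakeParameter_le_sqrt_holds`). In print
the strict inequality is the local Cor. (2.5) of Jacquet–Shalika I (unitary generic unramified
representations), from which (2.3) is deduced; the tree proves it unconditionally in ranks `≤ 2`
only (`norm_satakeParameter_lt_sqrt_of_le_two`).
[cite: JacquetShalikaAJM1981, Cor. (2.5) p. 515 and (5.1.3) p. 554] [cite: ArthurClozelAMS120, Ch. 3 §2 (2.3)] -/
theorem norm_lt_sqrt_of_pole_of_eq_conj
    (h23 : JacquetShalika1981_partialPairL_pole_of_eq_conj (n := n) (K := K) (μ := μ))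
    (hn : 0 < n) (P : CuspidalAutomorphicRepGL n K μ) {S : Set (HeightOneSpectrum (𝓞 K))}
    (hS : S.Finite) {α : SatakeFamily K} (hα : IsSatakeFamilyOf P S α)
    {v : HeightOneSpectrum (𝓞 K)} (hv : v ∉ S) {a : ℂ} (ha : a ∈ α v) :
    ‖a‖ < Real.sqrt v.residueCard := by
  have hle : ‖a‖ ≤ Real.sqrt v.residueCard := norm_satakeParameter_le_sqrt_holds P hα hv ha
  refine lt_of_le_of_ne hle fun heq => ?_
  apply eval_satakePairPolynomial_conj_ne_zero_of_pole h23 hn P hS hα hv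
  -- the pair `(ā, a)` contributes the factor `1 - ā a q_v^{-1} = 1 - |a|² / q_v = 0`
  rw [satakePairPolynomial_eq_eulerPolynomial, eval_eulerPolynomial]
  apply Multiset.prod_eq_zero
  refine Multiset.mem_map.mpr ⟨starRingEnd ℂ a * a, ?_, ?_⟩
  · simp only [satakeTensor, Multiset.mem_map, Multiset.mem_product]
    exact ⟨(starRingEnd ℂ a, a), ⟨⟨a, ha, rfl⟩, ha⟩, rfl⟩
  · have hq0 : (0 : ℝ) ≤ v.residueCard := by positivity
    have hmul : starRingEnd ℂ a * a = (v.residueCard : ℂ) := by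
      rw [Complex.conj_mul', heq, ← Complex.ofReal_natCast, ← Complex.ofReal_pow, Real.sq_sqrt hq0]
    have hq' : (v.residueCard : ℂ) ≠ 0 := by
      exact_mod_cast (zero_lt_one.trans v.one_lt_residueCard).ne'
    rw [hmul, Complex.cpow_neg_one, mul_inv_cancel₀ hq', sub_self]

end StrictBound

/-! ### (2.3) for Borel–Jacquet data from (2.3) in `L²` and the dictionary -/

section OfL2

/-- **(2.3) for Borel–Jacquet data from (2.3) in `L²` alone.** Granting, for all `GL_n` over all
number fields and all automorphic measures, the `L²` fact (2.3) (`h23`), the Borel–Jacquet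
dictionary (`hA`, `hL2`) and clean models (`hcl`), the fact
`JacquetShalika1981_partialPairL_pole_repData` holds — without the (2.2) facts and multiplicity one
used by `JacquetShalika1981_partialPairL_pole_repData_of_L2`. Proof (module docstring): normalise
`t_π = q^{s₁} t_{π₀}`, `t_σ = q^{s₂} t_{σ₀}` in one `L²_cusp` (`re sᵢ = 0` by unitarity); off the
finite `T = S ∪ E` the hypothesis `s₀ ∈ X` reads `t_{σ₀,w} = q_w^{-u} \bar t_{π₀,w}`,
`u = 1 - s₀ + s₁ + s₂`, `re u = 0`, so `t_σ = q^{s₂ - u} \bar t_{π₀}` off `T` and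
`(s - s₀) L^T(s, π ⊗ σ) = (s' - 1) L^T(s', π₀ ⊗ π̄₀)`, `s' = s + 1 - s₀`
(`tendsto_sub_mul_partialPairL_of_shift`), which tends to `c ≠ 0` by `h23` for `(π₀, π̄₀)`; then
`T ↓ S` by `exists_ne_zero_tendsto_mul_partialPairL_of_subset`, the moved factors being multipliable
companions of (2.1) (`JacquetShalika1981_multipliable_partialPairL_holds`) and non-zero at `s₀` by
`eval_satakePairPolynomial_ne_zero_of_lt_sqrt` with the strict bound for `π₀`
(`norm_lt_sqrt_of_pole_of_eq_conj`, from `h23`) and (5.1.3) for `σ₀`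
(`norm_satakeParameter_le_sqrt_holds`).
[cite: ArthurClozelAMS120, Ch. 3 §2 (2.3)] [cite: JacquetShalikaAJM1981II, Prop. 3.6]
[cite: JacquetShalikaAJM1981, (5.1) p. 554 and Cor. (2.5)] -/
theorem JacquetShalika1981_partialPairL_pole_repData_of_L2'
    (h23 : ∀ {n : ℕ} {K : Type} [Field K] [NumberField K] {μ : Measure (gl n K).automorphicQuotient}
      [(gl n K).IsAutomorphicMeasure μ],
      JacquetShalika1981_partialPairL_pole_of_eq_conj (n := n) (K := K) (μ := μ))
    (hA : ∀ {n : ℕ} {K : Type} [Field K] [NumberField K] (hK : isCompact_glFiniteIntegralLevel n K)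
      (μ : Measure (gl n K).automorphicQuotient) [(gl n K).IsAutomorphicMeasure μ],
      AutomorphicRepsGL.exists_isAssociatedL2 hK μ)
    (hL2 : ∀ {n : ℕ} {K : Type} [Field K] [NumberField K] (hK : isCompact_glFiniteIntegralLevel n K)
      (μ : Measure (gl n K).automorphicQuotient) [(gl n K).IsAutomorphicMeasure μ],
      hasSatakeParamAt_iff_L2 hK μ)
    (hcl : ∀ {n : ℕ} {K : Type} [Field K] [NumberField K] (hK : isCompact_glFiniteIntegralLevel n K)
      [NeZero n] (π : CuspidalAutomorphicRepData n K hK), ∃ π₀ : CuspidalAutomorphicRepData n K hK,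
        π₀.1.W' = ⊥ ∧ ∀ (v : HeightOneSpectrum (𝓞 K)) (β : Multiset ℂ),
          π₀.1.HasSatakeParamAt v β → π.1.HasSatakeParamAt v β) :
    JacquetShalika1981_partialPairL_pole_repData := by
  intro n F _ _ hF hn π π'
  haveI : NeZero n := ⟨hn.ne'⟩
  haveI := infinite_heightOneSpectrum F
  obtain ⟨μ, hμ⟩ := AdelicGroupData.exists_isAutomorphicMeasure_gl_holds n F
  haveI := hμ
  obtain ⟨s₁, s₂, P, P', S₀, αP, αP', hS₀, hαP, hαP', hiff, hiff'⟩ :=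
    CuspidalAutomorphicRepData.exists_pair_satake_eq_cpow_mul_L2 (hA hF μ) (hL2 hF μ) (hA hF μ)
      (hL2 hF μ) π π' (hcl hF π) (hcl hF π')
  refine ⟨S₀, hS₀, ?_⟩
  intro S hS hS₀S α β hα hβ hu hu' s₀ hs₀ hX
  have hαe := eq_map_cpow_mul_of_hasSatakeParamAt hS₀S hiff hα
  have hβe := eq_map_cpow_mul_of_hasSatakeParamAt hS₀S hiff' hβ
  obtain ⟨w₀, hw₀⟩ := hS.infinite_compl.nonempty
  have hs₁ : s₁.re = 0 :=
    re_eq_zero_of_norm_prod_eq_one_of_shift (hαP.mono hS₀S) hn hw₀ (hαe w₀ hw₀) (hu w₀ hw₀)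
  have hs₂ : s₂.re = 0 :=
    re_eq_zero_of_norm_prod_eq_one_of_shift (hαP'.mono hS₀S) hn hw₀ (hβe w₀ hw₀) (hu' w₀ hw₀)
  have hz : (s₁ + s₂).re = 0 := by rw [Complex.add_re, hs₁, hs₂, add_zero]
  -- the finite exceptional set of `s₀ ∈ X`, and the relation off `T = S ∪ E` in `L²` terms
  set E : Set (HeightOneSpectrum (𝓞 F)) :=
    {w | ¬ ((α w).map (((w.residueCard : ℂ) ^ (1 - s₀)) * ·) = (β w).map (·⁻¹))} with hE
  have hEfin : E.Finite := Filter.eventually_cofinite.1 hX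
  set T : Set (HeightOneSpectrum (𝓞 F)) := S ∪ E with hT
  have hTfin : T.Finite := hS.union hEfin
  have hST : S ⊆ T := Set.subset_union_left
  have hS₀T : S₀ ⊆ T := hS₀S.trans hST
  set u : ℂ := 1 - s₀ + (s₁ + s₂) with hudef
  have hu0 : u.re = 0 := by
    rw [hudef, Complex.add_re, Complex.sub_re, Complex.one_re, hs₀, hz, sub_self, add_zero]
  have hrel : ∀ w ∉ T,
      (αP w).map (((w.residueCard : ℂ) ^ u) * ·) = (αP' w).map (starRingEnd ℂ) := by
    intro w hw
    have hwS : w ∉ S := fun h => hw (hST h)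
    have hwE : (α w).map (((w.residueCard : ℂ) ^ (1 - s₀)) * ·) = (β w).map (·⁻¹) := by
      by_contra h
      exact hw (Or.inr h)
    have hq : w.residueCard ≠ 0 := by have := w.one_lt_residueCard; omega
    rw [hαe w hwS, hβe w hwS, map_cpow_mul_map_cpow_mul_eq_map_inv_map_cpow_mul_iff hq,
      (hαP'.mono hS₀S).map_inv_eq_map_conj hwS] at hwE
    exact hwE
  -- off `T`: `t_π = q^{s₁} t_{π₀}` and `t_σ = q^{s₂ - u} \bar t_{π₀}`
  have hαT : ∀ w ∉ T, α w = (αP w).map (((w.residueCard : ℂ) ^ s₁) * ·) :=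
    fun w hw => hαe w (fun h => hw (hST h))
  have hγ : IsSatakeFamilyOf P.conj S₀ fun w => (αP w).map (starRingEnd ℂ) := hαP.conj
  have hβT : ∀ w ∉ T, β w =
      ((fun w => (αP w).map (starRingEnd ℂ)) w).map (((w.residueCard : ℂ) ^ (s₂ - u)) * ·) := by
    intro w hw
    have hwS : w ∉ S := fun h => hw (hST h)
    have hq' : (w.residueCard : ℂ) ≠ 0 := by
      exact_mod_cast (zero_lt_one.trans w.one_lt_residueCard).ne'
    have h1 : αP' w = ((αP w).map (((w.residueCard : ℂ) ^ u) * ·)).map (starRingEnd ℂ) := by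
      rw [hrel w hw, Multiset.map_map, Function.comp_def]
      simp only [Complex.conj_conj, Multiset.map_id']
    rw [hβe w hwS, h1]
    simp only [Multiset.map_map, Function.comp_def, map_mul]
    refine Multiset.map_congr rfl fun a _ => ?_
    rw [conj_natCast_cpow_of_re_eq_zero hu0, ← mul_assoc, ← Complex.cpow_add _ _ hq',
      ← sub_eq_add_neg]
  -- the pole of `L^T(·, π₀ ⊗ π̄₀)` at `1` ((2.3) in `L²`) is a pole of `L^T(·, π ⊗ σ)` at `s₀`
  have hz' : (s₁ + (s₂ - u)).re = 0 := by
    rw [Complex.add_re, Complex.sub_re, hs₁, hs₂, hu0]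
    ring
  have hs₀' : s₀ - (s₁ + (s₂ - u)) = 1 := by
    rw [hudef]
    ring
  obtain ⟨c, hc, hlim⟩ :=
    h23 hn P P.conj P.conj_conj.symm hTfin (hαP.mono hS₀T) (hγ.mono hS₀T)
  have hTlim : Tendsto (fun s => (s - s₀) * partialPairL T α β s) (𝓝[{s : ℂ | 1 < s.re}] s₀)
      (𝓝 c) := by
    refine tendsto_sub_mul_partialPairL_of_shift hαT hβT hz' ?_
    rw [hs₀']
    exact hlim
  -- descend from `T` to `S`
  refine exists_ne_zero_tendsto_mul_partialPairL_of_subset hST (hEfin.subset ?_) (fun s => s - s₀)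
    ?_ ?_ ⟨c, hc, hTlim⟩
  · rintro w ⟨hwT | hwE, hwS⟩
    · exact absurd hwT hwS
    · exact hwE
  · -- multipliability over `v ∉ T` for `Re s > 1`: (2.1) for `(π₀, σ₀)` after the shift
    filter_upwards [self_mem_nhdsWithin] with s hs
    have hβT' : ∀ w ∉ T, β w = (αP' w).map (((w.residueCard : ℂ) ^ s₂) * ·) :=
      fun w hw => hβe w (fun h => hw (hST h))
    rw [pairEulerFactor_eq_of_shift hαT hβT' s]
    refine JacquetShalika1981_multipliable_partialPairL_holds P P' (hαP.mono hS₀T) (hαP'.mono hS₀T) ?_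
    rw [Complex.sub_re, hz, sub_zero]
    exact hs
  · -- the moved factors are non-zero at `s₀`: strict bound for `π₀`, (5.1.3) for `σ₀`
    rintro w ⟨-, hwS⟩
    have hwS₀ : w ∉ S₀ := fun h => hwS (hS₀S h)
    have hq : w.residueCard ≠ 0 := by have := w.one_lt_residueCard; omega
    rw [hαe w hwS, hβe w hwS, eval_satakePairPolynomial_map_mul_map_mul,
      natCast_cpow_mul_cpow_mul_cpow_neg _ hq]
    refine eval_satakePairPolynomial_ne_zero_of_lt_sqrt w.one_lt_residueCard
      (fun a ha => norm_lt_sqrt_of_pole_of_eq_conj h23 hn P hS₀ hαP hwS₀ ha)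
      (fun b hb => norm_satakeParameter_le_sqrt_holds P' hαP' hwS₀ hb) ?_
    rw [Complex.sub_re, hz, sub_zero, hs₀]

end OfL2

/-! ### (2.3) for Borel–Jacquet data from the named-fact leaves: four leaves -/

section OfLeaves

/-- **(2.3) for Borel–Jacquet data from four named-fact leaves**: as
`JacquetShalika1981_partialPairL_pole_repData_of_L2'`, with the clean models supplied by the
semisimplicity of `A_G`-invariant cusp forms (`AutomorphicRepsGL.stable_cuspidal_eq_sSup_irreducible`,
via `CuspidalAutomorphicRepData.exists_clean_hasSatakeParamAt_of_sSup_irreducible`). So the fact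
`JacquetShalika1981_partialPairL_pole_repData` follows from the discharges of
`JacquetShalika1981_partialPairL_pole_of_eq_conj`, `AutomorphicRepsGL.exists_isAssociatedL2`,
`hasSatakeParamAt_iff_L2` and `AutomorphicRepsGL.stable_cuspidal_eq_sSup_irreducible` alone.
[cite: ArthurClozelAMS120, Ch. 3 §2 (2.3)] -/
theorem JacquetShalika1981_partialPairL_pole_repData_of_leaves'
    (h23 : ∀ {n : ℕ} {K : Type} [Field K] [NumberField K] {μ : Measure (gl n K).automorphicQuotient}
      [(gl n K).IsAutomorphicMeasure μ],
      JacquetShalika1981_partialPairL_pole_of_eq_conj (n := n) (K := K) (μ := μ))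
    (hA : ∀ {n : ℕ} {K : Type} [Field K] [NumberField K] (hK : isCompact_glFiniteIntegralLevel n K)
      (μ : Measure (gl n K).automorphicQuotient) [(gl n K).IsAutomorphicMeasure μ],
      AutomorphicRepsGL.exists_isAssociatedL2 hK μ)
    (hL2 : ∀ {n : ℕ} {K : Type} [Field K] [NumberField K] (hK : isCompact_glFiniteIntegralLevel n K)
      (μ : Measure (gl n K).automorphicQuotient) [(gl n K).IsAutomorphicMeasure μ],
      hasSatakeParamAt_iff_L2 hK μ)
    (hss : ∀ {n : ℕ} {K : Type} [Field K] [NumberField K] (hK : isCompact_glFiniteIntegralLevel n K),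
      AutomorphicRepsGL.stable_cuspidal_eq_sSup_irreducible hK) :
    JacquetShalika1981_partialPairL_pole_repData :=
  JacquetShalika1981_partialPairL_pole_repData_of_L2' h23 hA hL2 fun hK _ π =>
    CuspidalAutomorphicRepData.exists_clean_hasSatakeParamAt_of_sSup_irreducible (hss hK) π

end OfLeaves

end Literature.NumberTheory.Automorphic

end
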